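import Summits.QuantumFields.YangMills.Theorems.FemtoTransferGapLevelsPos
import Summits.QuantumFields.YangMills.Theorems.FemtoTransferGapGroundState
import Summits.QuantumFields.YangMills.Theorems.FlatTubeReductionOffTubeSuppressionPrelim
import HarnessLib

/-!
# The positive ground state realises the min–max: `f ⊥ Ω ⇒ ⟨f, K_β f⟩ ≤ λ₁‖f‖²`
# (stub `OneSiteGroundMinMax` of the planner's BC3 skeletons of crux K1a `PinnedTubeRatioLaw`, stmt-QuantumFields-24921, and of its parent
# K1 `NearFlatRatioLaw`, stmt-QuantumFields-24720; route `FlatTubeReduction`, rung R2b1 = RECORD-label femto gap)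

Seat `ym-line-sfw-p1` g9 (prover; planner-of-record ym-idea-1).  For the zero-flux `SU(2)` transfer operator on `(ℤ/L)³` (every `L ≥ 1`,
every `β > 0`): if `Ω` is ANY everywhere-positive physical exact top eigenfunction (`K_βΩ = λ₀Ω`) then every physical `f ⊥ Ω` has
`⟨f, K_β f⟩ ≤ λ₁ ‖f‖²` with `λ₁ = levelValue su2Rep L β 1 = secondValue` — i.e. `Ω` is an optimal test vector in the min–max definition of `λ₁`.

Proof: the tree's spectral attainment with Courant–Fischer domination (`exists_isPhys_eigenfamily_dominating_of_pos`, k = 1) gives orthonormal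
physical `e₀, e₁` with `K e₀ = λ₀ e₀` and `⟨ψ,Kψ⟩ ≤ λ₁‖ψ‖²` for physical `ψ ⊥ e₀`; the top eigenvalue is simple (`levelValue_one_lt_levelValue_zero`,
Jentzsch): `g = Ω − ⟨Ω,e₀⟩e₀ ⊥ e₀` is again a `λ₀`-eigenvector in the form sense, `λ₀‖g‖² = ⟨g,Kg⟩ ≤ λ₁‖g‖²`, so `‖g‖² = 0`; hence
`⟨Ω,e₀⟩ ≠ 0` (`Ω > 0` has `‖Ω‖² > 0`) and `f ⊥ Ω ⇒ f ⊥ e₀` (Cauchy–Schwarz against `g`), and domination applies.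

* ★ `qform_le_levelValue_one_of_orth_ground` — every `L`, `β > 0`;
* ★★ `oneSiteGroundMinMax` — VERBATIM the stub `OneSiteGroundMinMax` (`L = 1`, `B ≥ 1`) shared by the planner's skeletons
  `PinnedTubeRatioLaw_birth.lean` (K1a ⇐ `PinnedFeshbachUpper` ∧ THIS) and `NearFlatRatioLaw_birth.lean`.

HONEST FRAMING: fixed-lattice functional analysis; the Feshbach/Born–Oppenheimer stub `PinnedFeshbachUpper` (XL) is OPEN.  R2b1 is a RECORD rung:
nothing here concerns infinite volume, the continuum, or the Clay Yang–Mills mass gap.  No definitions, no named facts, no `sorry`.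
-/

set_option autoImplicit false

noncomputable section

open MeasureTheory Filter Topology Real
open Literature.MathematicalPhysics.QuantumFieldTheory
open Literature.MathematicalPhysics.QuantumLattice

namespace Summit.QuantumFields.YangMills.Theorems.FemtoTransferGap

namespace TubeMax

open Summit.QuantumFields.YangMills.Theorems.FemtoTransferGap.OffTube

variable {L : ℕ} [NeZero L]

/-- ★ **A positive top eigenfunction realises the min–max.**  `β > 0`; `Ω` physical, everywhere positive, `K_βΩ = λ₀Ω`; then every physical
`f ⊥ Ω` has `⟨f, K_β f⟩ ≤ levelValue su2Rep L β 1 · ‖f‖²`. [cite: ReedSimonIV1978, Thm. XIII.1] -/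
theorem qform_le_levelValue_one_of_orth_ground {β : ℝ} (hβ : 0 < β) {Ω f : GaugeConfig 3 L SU2 → ℝ} (hΩ : IsPhys Ω)
    (hΩpos : ∀ U, 0 < Ω U) (heig : transferApply β Ω = topValue su2Rep L β • Ω) (hf : IsPhys f) (horth : l2 f Ω = 0) :
    qform su2Rep β f f ≤ levelValue su2Rep L β 1 * l2 f f := by
  obtain ⟨e, he, hon, heeig, hdom⟩ := exists_isPhys_eigenfamily_dominating_of_pos (L := L) hβ 1
  have he0 : IsPhys (e 0) := he 0
  have hn0 : l2 (e 0) (e 0) = 1 := by rw [hon 0 0, if_pos rfl]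
  have heig0 : transferApply β (e 0) = topValue su2Rep L β • e 0 := by rw [heeig 0]; simp [levelValue_zero]
  have hdom' : ∀ ψ : GaugeConfig 3 L SU2 → ℝ, IsPhys ψ → l2 ψ (e 0) = 0 → qform su2Rep β ψ ψ ≤ levelValue su2Rep L β 1 * l2 ψ ψ := by
    intro ψ hψ h0
    exact hdom 1 ψ hψ fun i hi => by
      fin_cases i
      · exact h0
      · exact absurd hi (by decide)
  -- the component of `Ω` orthogonal to `e 0`
  set c : ℝ := l2 Ω (e 0) with hc
  have hg : IsPhys (Ω + (-c) • e 0) := hΩ.add (he0.smul (-c))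
  have hg_orth : l2 (Ω + (-c) • e 0) (e 0) = 0 := by
    rw [l2_add_left hΩ (he0.smul (-c)) he0, l2_smul_left, hn0, hc]; ring
  -- `⟨g, K g⟩ = λ₀ ‖g‖²` (both `Ω` and `e 0` are `λ₀`-eigenfunctions)
  have hqg : qform su2Rep β (Ω + (-c) • e 0) (Ω + (-c) • e 0) = topValue su2Rep L β * l2 (Ω + (-c) • e 0) (Ω + (-c) • e 0) := by
    rw [qform_add_right β hg hΩ (he0.smul (-c)), qform_smul_right β (-c) hg he0, qform_eigen_right β heig, qform_eigen_right β heig0,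
      l2_comm (Ω + (-c) • e 0) (Ω + (-c) • e 0), l2_add_left hΩ (he0.smul (-c)) hg, l2_smul_left, l2_comm Ω (Ω + (-c) • e 0),
      l2_comm (e 0) (Ω + (-c) • e 0)]
    ring
  -- simplicity: `λ₁ < λ₀` forces `‖g‖² = 0`
  have hgap : levelValue su2Rep L β 1 < topValue su2Rep L β := by
    rw [← levelValue_zero]; exact PhysL2.levelValue_one_lt_levelValue_zero β
  have hg0 : l2 (Ω + (-c) • e 0) (Ω + (-c) • e 0) = 0 := by
    have h1 := hdom' _ hg hg_orth
    rw [hqg] at h1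
    have h2 : 0 ≤ l2 (Ω + (-c) • e 0) (Ω + (-c) • e 0) := l2_self_nonneg _
    nlinarith
  -- `f ⊥ Ω` implies `f ⊥ e 0`: `⟨f, g⟩ = 0` by Cauchy–Schwarz, and `c ≠ 0` since `‖Ω‖² > 0`
  have hfg : l2 f (Ω + (-c) • e 0) = 0 := by
    have hcs := sq_l2_le hf hg
    rw [hg0, mul_zero] at hcs
    exact pow_eq_zero_iff (n := 2) (by norm_num) |>.1 (le_antisymm hcs (sq_nonneg _))
  have hN0 : 0 < l2 Ω Ω := by
    obtain ⟨c₀, hc₀, hc₀le⟩ := PhysL2.exists_pos_le_of_eigen (topValue_su2Rep_pos L β) hΩ hΩpos heig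
    exact l2_pos_of_le hΩ hΩ hc₀ hc₀ hc₀le hc₀le
  have hc_ne : c ≠ 0 := by
    intro h0
    have h1 : l2 (Ω + (-c) • e 0) (Ω + (-c) • e 0) = l2 Ω Ω := by
      rw [h0, neg_zero, zero_smul, add_zero]
    rw [h1] at hg0
    exact hN0.ne' hg0
  have hfe : l2 f (e 0) = 0 := by
    have h1 : l2 f (Ω + (-c) • e 0) = l2 f Ω + (-c) * l2 f (e 0) := by
      rw [l2_comm, l2_add_left hΩ (he0.smul (-c)) hf, l2_smul_left, l2_comm Ω f, l2_comm (e 0) f]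
    rw [hfg, horth, zero_add] at h1
    have : -c * l2 f (e 0) = 0 := h1.symm
    rcases mul_eq_zero.1 this with h | h
    · exact absurd (neg_eq_zero.1 h) hc_ne
    · exact h
  exact hdom' f hf hfe

/-- ★★ **`OneSiteGroundMinMax`** — VERBATIM the stub shared by the planner's BC3 skeletons of K1a `PinnedTubeRatioLaw` (stmt-QuantumFields-24921)
and K1 `NearFlatRatioLaw` (stmt-QuantumFields-24720): on the one-site lattice, at every coupling `B ≥ 1`, a physical `f` orthogonal to a positive
top eigenfunction `Ω₁` has `⟨f, K_B f⟩ ≤ μ₁(B)‖f‖²`, `μ₁ = levelValue su2Rep 1 B 1`. [cite: ReedSimonIV1978, Thm. XIII.1] -/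
theorem oneSiteGroundMinMax :
    ∀ B : ℝ, 1 ≤ B → ∀ (Ω₁ f : Literature.MathematicalPhysics.QuantumFieldTheory.GaugeConfig 3 1 SU2 → ℝ), IsPhys Ω₁ → (∀ U, 0 < Ω₁ U) →
      transferApply B Ω₁ = topValue su2Rep 1 B • Ω₁ → IsPhys f → l2 f Ω₁ = 0 → qform su2Rep B f f ≤ levelValue su2Rep 1 B 1 * l2 f f :=
  fun _ hB _ _ hΩ hΩpos heig hf horth =>
    qform_le_levelValue_one_of_orth_ground (lt_of_lt_of_le one_pos hB) hΩ hΩpos heig hf horth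

end TubeMax

end Summit.QuantumFields.YangMills.Theorems.FemtoTransferGap

end
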